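import Literature.Probability.LatticeModels.IsingModel
import HarnessLib

/-!
# The Aizenman–Graham inequality (finite volume, free boundary condition, zero field)

Topic `Literature/Probability/LatticeModels`, namespace `Literature.Probability.LatticeModels`.
This file vendors, as a NAMED FACT in finite volume, the **Aizenman–Graham inequality** — the
"inequality in the direction opposite to Lebowitz'" bounding the connected four-point function
`u⁽⁴⁾` of the ferromagnetic Ising model from BELOW by a bubble-like term times a *raw* truncated
pair–pair correlation — in the form printed and proved (by random currents) in

* H. Tasaki, T. Hara, *相転移と臨界現象の数理* (Mathematical theory of phase transitions and
  critical phenomena), Kyoritsu 2015, Appendix A, §3.6, Theorem A.18, eq. (A.125)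
  [TasakiHara2015]: for the Ising system with couplings `Ĵ ≥ 0` and field `ĥ = 0` on a finite
  lattice `Λ` and any `x₁, x₂, x₃, x₄ ∈ Λ`,
  `u⁽⁴⁾_Λ(x₁,x₂,x₃,x₄) ≥ -Σ_{u,v∈Λ} ⟨σ_{x₁}σ_v⟩_Λ ⟨σ_{x₂}σ_v⟩_Λ (tanh Ĵ_{u,v}) ⟨σ_uσ_v ; σ_{x₃}σ_{x₄}⟩_Λ`
  `- ⟨σ_{x₁}σ_{x₃}⟩_Λ⟨σ_{x₂}σ_{x₃}⟩_Λ⟨σ_{x₄}σ_{x₃}⟩_Λ - ⟨σ_{x₁}σ_{x₄}⟩_Λ⟨σ_{x₂}σ_{x₄}⟩_Λ⟨σ_{x₃}σ_{x₄}⟩_Λ`,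
  where `u⁽⁴⁾_Λ(x₁,x₂,x₃,x₄) = ⟨σ₁σ₂σ₃σ₄⟩ - ⟨σ₁σ₂⟩⟨σ₃σ₄⟩ - ⟨σ₁σ₃⟩⟨σ₂σ₄⟩ - ⟨σ₁σ₄⟩⟨σ₂σ₃⟩`
  (ibid., (A.123)) and `⟨A ; B⟩ = ⟨AB⟩ - ⟨A⟩⟨B⟩`;
* the original: M. Aizenman, R. Graham, Nucl. Phys. B 225 (1983) 261–288 [AizenmanGraham1983]
  (not held; Tasaki–Hara, notes to Ch. 10: "d = 4 での定理 10.14 は Aizenman, Graham [52] による.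
  ここで紹介した (d > 4 での) 証明は [52] の線に沿っている").

It is the input of the proof that the bubble condition forces the mean-field divergence of the
susceptibility (`γ = 1`; Tasaki–Hara, Thm. 10.13, eqs. (10.63)–(10.69); Aizenman 1982,
Aizenman–Graham 1983; quoted by Sakai 2007, §1.1), see
`Literature/Barriers/CriticalPhenomena/LaceExpansionIsingAboveFour*.lean`.

## What is here

* `isingFourPoint`, `isingPairCov` (`⟨σ_uσ_v ; σ_xσ_y⟩`), `isingUrsellFour` (`u⁽⁴⁾` in the pairing
  form (A.123)) for the tree's finite-volume Gibbs state `isingExpect G Λ β h bc`, with the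
  identification `isingUrsellFour = connectedFour (isingMeasure …) spinAt ![x₁,x₂,x₃,x₄]`
  (the tree's pairing-form `U₄` of `Correlations.lean`) and the elementary symmetries;
* the named fact `aizenmanGraham_inequality G Λ β` (Theorem A.18 for the tree's model: uniform
  coupling `β ≥ 0` on the edges of a locally finite graph `G` inside the finite volume `Λ`, free
  boundary condition, zero field; `tanh Ĵ_{u,v} = tanh β · 1[u ∼ v]`, the sum running over
  ordered pairs of adjacent vertices of `Λ`). Transcription choices: only the uniform-coupling,
  zero-field, free-boundary case of the printed statement (the tree's `isingMeasure` has one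
  coupling `β`); all four points are required to lie in `Λ` as printed. The discharge
  `aizenmanGraham_inequality_holds` (random-current proof of ibid., pp. 262–266) is the business of
  a sibling proofs file. The companion Aizenman inequality (A.124) is the tree's
  `Literature.Barriers.CriticalPhenomena.treeDiagramBound` and is not restated.

## References

* H. Tasaki, T. Hara, 相転移と臨界現象の数理, Kyoritsu Shuppan 2015, App. A §3.6, Thm. A.18
  (A.125), (A.123); Ch. 10 §3.3 [TasakiHara2015].
* M. Aizenman, R. Graham, Nucl. Phys. B 225 (1983) 261–288 [AizenmanGraham1983].
* M. Aizenman, Comm. Math. Phys. 86 (1982) 1–48 [Aizenman1982].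
-/

noncomputable section

namespace Literature.Probability.LatticeModels

open MeasureTheory Finset

variable {V : Type*} [DecidableEq V] (G : SimpleGraph V) [G.LocallyFinite]

/-! ### Four-point functions of the finite-volume state -/

/-- The finite-volume four-point function `⟨σ_{x₁}σ_{x₂}σ_{x₃}σ_{x₄}⟩^{bc}_{Λ;β,h}` of the
tree's Gibbs state, as the expectation of `(σ_{x₁}σ_{x₂})(σ_{x₃}σ_{x₄})` (coincident points
allowed, `σ_x² = 1`). [cite: TasakiHara2015, App. A, eq. (A.123)] -/
def isingFourPoint (Λ : Finset V) (β h : ℝ) (bc : BoundaryCondition V) (x₁ x₂ x₃ x₄ : V) : ℝ :=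
  isingExpect G Λ β h bc fun σ => spinPair x₁ x₂ σ * spinPair x₃ x₄ σ

/-- The truncated pair–pair correlation `⟨σ_uσ_v ; σ_xσ_y⟩ = ⟨σ_uσ_vσ_xσ_y⟩ - ⟨σ_uσ_v⟩⟨σ_xσ_y⟩`
(Tasaki–Hara write `⟨A ; B⟩ := ⟨AB⟩ - ⟨A⟩⟨B⟩`; for an edge `{u,v}` this is the summand of
`∂_β ⟨σ_xσ_y⟩`). [cite: TasakiHara2015, App. A, Thm. A.18 (A.125)] -/
def isingPairCov (Λ : Finset V) (β h : ℝ) (bc : BoundaryCondition V) (u v x y : V) : ℝ :=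
  isingFourPoint G Λ β h bc u v x y - isingTwoPoint G Λ β h bc u v * isingTwoPoint G Λ β h bc x y

/-- The connected four-point function in the pairing form
`u⁽⁴⁾(x₁,x₂,x₃,x₄) = ⟨σ₁σ₂σ₃σ₄⟩ - ⟨σ₁σ₂⟩⟨σ₃σ₄⟩ - ⟨σ₁σ₃⟩⟨σ₂σ₄⟩ - ⟨σ₁σ₄⟩⟨σ₂σ₃⟩` of the
finite-volume state (Tasaki–Hara (A.123); it is `connectedFour` of `Correlations.lean` for the
Gibbs measure, `isingUrsellFour_eq_connectedFour`). [cite: TasakiHara2015, App. A, eq. (A.123)] -/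
def isingUrsellFour (Λ : Finset V) (β h : ℝ) (bc : BoundaryCondition V) (x₁ x₂ x₃ x₄ : V) : ℝ :=
  isingFourPoint G Λ β h bc x₁ x₂ x₃ x₄
    - isingTwoPoint G Λ β h bc x₁ x₂ * isingTwoPoint G Λ β h bc x₃ x₄
    - isingTwoPoint G Λ β h bc x₁ x₃ * isingTwoPoint G Λ β h bc x₂ x₄
    - isingTwoPoint G Λ β h bc x₁ x₄ * isingTwoPoint G Λ β h bc x₂ x₃

variable (Λ : Finset V) (β h : ℝ) (bc : BoundaryCondition V)

omit [DecidableEq V] in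
/-- `(σ_{x₁}σ_{x₂})(σ_{x₃}σ_{x₄})` is the spin monomial `∏ᵢ σ_{xᵢ}` of `![x₁,x₂,x₃,x₄]`. [folklore] -/
theorem spinPair_mul_spinPair_eq_prod (x₁ x₂ x₃ x₄ : V) (σ : SpinConfig V) :
    spinPair x₁ x₂ σ * spinPair x₃ x₄ σ = ∏ i : Fin 4, spinAt (![x₁, x₂, x₃, x₄] i) σ := by
  rw [Fin.prod_univ_four]
  simp only [spinPair, Matrix.cons_val_zero, Matrix.cons_val_one, Matrix.cons_val]
  ring

/-- The four-point function is the `4`-point function `nPoint` of the Gibbs measure at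
`![x₁,x₂,x₃,x₄]`. [cite: TasakiHara2015, App. A, eq. (A.123)] -/
theorem isingFourPoint_eq_nPoint (x₁ x₂ x₃ x₄ : V) :
    isingFourPoint G Λ β h bc x₁ x₂ x₃ x₄ = nPoint (isingMeasure G Λ β h bc) spinAt ![x₁, x₂, x₃, x₄] := by
  unfold isingFourPoint isingExpect nPoint
  exact integral_congr_ae (ae_of_all _ fun σ => spinPair_mul_spinPair_eq_prod x₁ x₂ x₃ x₄ σ)

/-- **`u⁽⁴⁾` is the tree's pairing-form connected four-point function** `connectedFour` of the
finite-volume Gibbs measure. [cite: TasakiHara2015, App. A, eq. (A.123)] -/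
theorem isingUrsellFour_eq_connectedFour (x₁ x₂ x₃ x₄ : V) :
    isingUrsellFour G Λ β h bc x₁ x₂ x₃ x₄ =
      connectedFour (isingMeasure G Λ β h bc) spinAt ![x₁, x₂, x₃, x₄] := by
  rw [isingUrsellFour, connectedFour, isingFourPoint_eq_nPoint]
  rfl

/-- The four-point function is symmetric in its first pair. [folklore] -/
theorem isingFourPoint_comm12 (x₁ x₂ x₃ x₄ : V) :
    isingFourPoint G Λ β h bc x₁ x₂ x₃ x₄ = isingFourPoint G Λ β h bc x₂ x₁ x₃ x₄ := by
  unfold isingFourPoint spinPair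
  congr 1; funext σ; ring

/-- The four-point function is symmetric in its second pair. [folklore] -/
theorem isingFourPoint_comm34 (x₁ x₂ x₃ x₄ : V) :
    isingFourPoint G Λ β h bc x₁ x₂ x₃ x₄ = isingFourPoint G Λ β h bc x₁ x₂ x₄ x₃ := by
  unfold isingFourPoint spinPair
  congr 1; funext σ; ring

/-- The four-point function is symmetric under the exchange of its two pairs. [folklore] -/
theorem isingFourPoint_swap (x₁ x₂ x₃ x₄ : V) :
    isingFourPoint G Λ β h bc x₁ x₂ x₃ x₄ = isingFourPoint G Λ β h bc x₃ x₄ x₁ x₂ := by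
  unfold isingFourPoint spinPair
  congr 1; funext σ; ring

/-- The two-point function is symmetric. [folklore] -/
theorem isingTwoPoint_symm (x y : V) :
    isingTwoPoint G Λ β h bc x y = isingTwoPoint G Λ β h bc y x := by
  unfold isingTwoPoint spinPair
  congr 1; funext σ; ring

/-- `⟨σ_uσ_v ; σ_xσ_y⟩ = ⟨σ_vσ_u ; σ_xσ_y⟩`. [folklore] -/
theorem isingPairCov_comm12 (u v x y : V) :
    isingPairCov G Λ β h bc u v x y = isingPairCov G Λ β h bc v u x y := by
  unfold isingPairCov
  rw [isingFourPoint_comm12, isingTwoPoint_symm G Λ β h bc u v]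

/-- `⟨σ_uσ_v ; σ_xσ_y⟩ = ⟨σ_uσ_v ; σ_yσ_x⟩`. [folklore] -/
theorem isingPairCov_comm34 (u v x y : V) :
    isingPairCov G Λ β h bc u v x y = isingPairCov G Λ β h bc u v y x := by
  unfold isingPairCov
  rw [isingFourPoint_comm34, isingTwoPoint_symm G Λ β h bc x y]

/-- `⟨σ_uσ_v ; σ_xσ_y⟩ = ⟨σ_xσ_y ; σ_uσ_v⟩`. [folklore] -/
theorem isingPairCov_swap (u v x y : V) :
    isingPairCov G Λ β h bc u v x y = isingPairCov G Λ β h bc x y u v := by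
  unfold isingPairCov
  rw [isingFourPoint_swap, mul_comm]

/-- With a repeated point in a pair the four-point function is a two-point function:
`⟨σ_xσ_xσ_uσ_v⟩ = ⟨σ_uσ_v⟩`. [folklore] -/
theorem isingFourPoint_self_left (x u v : V) :
    isingFourPoint G Λ β h bc x x u v = isingTwoPoint G Λ β h bc u v := by
  unfold isingFourPoint isingTwoPoint
  congr 1; funext σ; simp [spinPair]

/-! ### The named fact -/

/-- **The Aizenman–Graham inequality, finite volume (named fact; Tasaki–Hara 2015, Thm. A.18,
eq. (A.125); Aizenman–Graham 1983).** For the Ising model on a locally finite graph `G` with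
uniform coupling `β ≥ 0` on the edges inside the finite volume `Λ`, free boundary condition and
zero field, and any `x₁, x₂, x₃, x₄ ∈ Λ`:
`u⁽⁴⁾_Λ(x₁,x₂,x₃,x₄) ≥ - tanh β · Σ_{u∈Λ} Σ_{v∈Λ, v∼u} ⟨σ_{x₁}σ_v⟩_Λ ⟨σ_{x₂}σ_v⟩_Λ ⟨σ_uσ_v ; σ_{x₃}σ_{x₄}⟩_Λ`
`  - ⟨σ_{x₁}σ_{x₃}⟩_Λ ⟨σ_{x₂}σ_{x₃}⟩_Λ ⟨σ_{x₄}σ_{x₃}⟩_Λ - ⟨σ_{x₁}σ_{x₄}⟩_Λ ⟨σ_{x₂}σ_{x₄}⟩_Λ ⟨σ_{x₃}σ_{x₄}⟩_Λ`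
— the printed `Σ_{u,v∈Λ} ⟨σ_{x₁}σ_v⟩⟨σ_{x₂}σ_v⟩ (tanh Ĵ_{u,v}) ⟨σ_uσ_v;σ_{x₃}σ_{x₄}⟩` with
`Ĵ_{u,v} = β·1[{u,v} ∈ ℰ_Λ]` (the finite system's couplings for the free boundary condition).
"The inequality opposite to Lebowitz' … the most powerful one known so far" (ibid., §A.3.6),
the input of `γ = 1` under the bubble condition (ibid., Thm. 10.13). Only the uniform-coupling,
zero-field case of the printed statement (couplings `Ĵ ≥ 0`, `ĥ = 0`) is transcribed. Named
fact, not proved here. [cite: TasakiHara2015, App. A, Thm. A.18 (A.125)]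
[cite: AizenmanGraham1983, as cited by Tasaki–Hara 2015, Ch. 10 notes ([52])] -/
def aizenmanGraham_inequality [DecidableRel G.Adj] (Λ : Finset V) (β : ℝ) : Prop :=
  0 ≤ β → ∀ ⦃x₁ x₂ x₃ x₄ : V⦄, x₁ ∈ Λ → x₂ ∈ Λ → x₃ ∈ Λ → x₄ ∈ Λ →
    -(Real.tanh β * ∑ u ∈ Λ, ∑ v ∈ Λ with G.Adj u v,
          isingTwoPoint G Λ β 0 .free x₁ v * isingTwoPoint G Λ β 0 .free x₂ v *
            isingPairCov G Λ β 0 .free u v x₃ x₄)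
      - isingTwoPoint G Λ β 0 .free x₁ x₃ * isingTwoPoint G Λ β 0 .free x₂ x₃ *
          isingTwoPoint G Λ β 0 .free x₄ x₃
      - isingTwoPoint G Λ β 0 .free x₁ x₄ * isingTwoPoint G Λ β 0 .free x₂ x₄ *
          isingTwoPoint G Λ β 0 .free x₃ x₄
    ≤ isingUrsellFour G Λ β 0 .free x₁ x₂ x₃ x₄

/-- The fact, unfolded: the lower bound on `u⁽⁴⁾` for a given quadruple of points of `Λ`.
[cite: TasakiHara2015, App. A, Thm. A.18 (A.125)] -/
theorem aizenmanGraham_inequality.le [DecidableRel G.Adj] {Λ : Finset V} {β : ℝ}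
    (hAG : aizenmanGraham_inequality G Λ β) (hβ : 0 ≤ β) {x₁ x₂ x₃ x₄ : V} (h₁ : x₁ ∈ Λ)
    (h₂ : x₂ ∈ Λ) (h₃ : x₃ ∈ Λ) (h₄ : x₄ ∈ Λ) :
    -(Real.tanh β * ∑ u ∈ Λ, ∑ v ∈ Λ with G.Adj u v,
          isingTwoPoint G Λ β 0 .free x₁ v * isingTwoPoint G Λ β 0 .free x₂ v *
            isingPairCov G Λ β 0 .free u v x₃ x₄)
      - isingTwoPoint G Λ β 0 .free x₁ x₃ * isingTwoPoint G Λ β 0 .free x₂ x₃ *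
          isingTwoPoint G Λ β 0 .free x₄ x₃
      - isingTwoPoint G Λ β 0 .free x₁ x₄ * isingTwoPoint G Λ β 0 .free x₂ x₄ *
          isingTwoPoint G Λ β 0 .free x₃ x₄
    ≤ isingUrsellFour G Λ β 0 .free x₁ x₂ x₃ x₄ :=
  hAG hβ h₁ h₂ h₃ h₄

/-- **Consequence: the four-point lower bound summed against nonnegative weights.** If the fact
holds at `β ≥ 0`, then for any finite families of points of `Λ` and weights the weighted sum of
`u⁽⁴⁾` is bounded below by the corresponding weighted sum of the Aizenman–Graham minorant (the
form in which (A.125) enters (10.66) of Tasaki–Hara, summed over `x ∈ Λ` and the edges `{u,v}`).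
[cite: TasakiHara2015, Ch. 10, eq. (10.66)] -/
theorem aizenmanGraham_inequality.sum_le [DecidableRel G.Adj] {Λ : Finset V} {β : ℝ}
    (hAG : aizenmanGraham_inequality G Λ β) (hβ : 0 ≤ β) {ι : Type*} (s : Finset ι)
    (p : ι → V × V × V × V) (hp : ∀ i ∈ s, (p i).1 ∈ Λ ∧ (p i).2.1 ∈ Λ ∧ (p i).2.2.1 ∈ Λ ∧ (p i).2.2.2 ∈ Λ) :
    ∑ i ∈ s, (-(Real.tanh β * ∑ u ∈ Λ, ∑ v ∈ Λ with G.Adj u v,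
          isingTwoPoint G Λ β 0 .free (p i).1 v * isingTwoPoint G Λ β 0 .free (p i).2.1 v *
            isingPairCov G Λ β 0 .free u v (p i).2.2.1 (p i).2.2.2)
      - isingTwoPoint G Λ β 0 .free (p i).1 (p i).2.2.1 * isingTwoPoint G Λ β 0 .free (p i).2.1 (p i).2.2.1 *
          isingTwoPoint G Λ β 0 .free (p i).2.2.2 (p i).2.2.1
      - isingTwoPoint G Λ β 0 .free (p i).1 (p i).2.2.2 * isingTwoPoint G Λ β 0 .free (p i).2.1 (p i).2.2.2 *
          isingTwoPoint G Λ β 0 .free (p i).2.2.1 (p i).2.2.2) ≤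
      ∑ i ∈ s, isingUrsellFour G Λ β 0 .free (p i).1 (p i).2.1 (p i).2.2.1 (p i).2.2.2 :=
  Finset.sum_le_sum fun i hi => hAG hβ (hp i hi).1 (hp i hi).2.1 (hp i hi).2.2.1 (hp i hi).2.2.2

end Literature.Probability.LatticeModels

end
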